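import Summits.Ventures.PercRepro.C025ProfilePLDCertificate
import Summits.Ventures.PercRepro.C025ProfilePLDSolidTable9n4A
import Summits.Ventures.PercRepro.C025ProfilePLDSolidTable9n4B
import Summits.Ventures.PercRepro.C025ProfilePLDSolidTable9n4C
import Summits.Ventures.PercRepro.C025ProfilePLDSolidTable9n4D

/-!
# THE PRESERVER `q₄′ = T₂₄ + 4·T₃₄` AT RANK ≤ 9: A LIFTED CERTIFICATE TABLE — THE THEOREM (night-3 g34)

`proofs/NIGHT3-G34-FASTLIFT.md` §1 (the preservers of g31 §5, §7 and g32 §6).  For a (PLD)-matroid `M` of rank ≤ 9, the family of shifted pairs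
`(ρI + a, ρ(E∖I) + b)` with multiplicities `w`, `(a, b, w)` ∈ [(2, 4, 1), (4, 2, 1), (3, 4, 4), (4, 3, 4)], satisfies every canonical (PLD) instance
`lo ≤ hi ≤ 13`, `δ ≤ 13`, `Θ = 0` or `lo + hi + δ` — the symmetric-coordinate Farkas certificates (HiGHS vertex + exact rational reconstruction,
lab/certtab_q.py) verified pointwise on `[0,9]²` by `decide` (`q4n4_table_9_part0`) and fed to the certificate lemma
`PLDCert.sum_le_of_cert` (`pld_conv_q4n4_of_eRank_le_9`).  This is the preserver the lift in `m` needs (`lift_instance_plane` /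
`lift_instance_solid`).  No `def`, no `instance`, no notation.  Axioms: standard.
-/

open scoped Matroid

namespace PercRepro

open Finset ThmH

namespace PLDPlaneTable

variable {α : Type} [DecidableEq α]

/-- THE PRESERVER AT RANK ≤ 9: every canonical (PLD) instance of the `q`-family of a (PLD)-matroid `M` of rank ≤ 9. -/
theorem pld_conv_q4n4_of_eRank_le_9 (M : Matroid α) [M.Finite] (hr : M.eRank ≤ 9)
    (hPLD : ∀ lo hi δ Θ : ℕ, Θ ≤ lo + hi + δ → (lo = 0 ∨ lo + hi + δ ≤ Θ) →
      (∑ I ∈ (gr M).powerset, (if lo ≤ (M.eRk (I : Set α)).toNat ∧ (M.eRk (I : Set α)).toNat ≤ hi ∧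
          Θ ≤ (M.eRk ((gr M \ I : Finset α) : Set α)).toNat + (M.eRk (I : Set α)).toNat then
          ((M.eRk ((gr M \ I : Finset α) : Set α)).toNat).choose δ else 0)) ≤
        ∑ I ∈ (gr M).powerset, (if lo + δ ≤ (M.eRk ((gr M \ I : Finset α) : Set α)).toNat ∧
          (M.eRk ((gr M \ I : Finset α) : Set α)).toNat ≤ hi + δ then
          ((M.eRk ((gr M \ I : Finset α) : Set α)).toNat).choose δ else 0))
    (lo hi δ : ℕ) (hlh : lo ≤ hi) (hhR : hi ≤ 13) (hδR : δ ≤ 13) :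
    ∑ I ∈ (gr M).powerset, (1 * (if lo ≤ (M.eRk (I : Set α)).toNat + 2 ∧ (M.eRk (I : Set α)).toNat + 2 ≤ hi ∧ (if lo = 0 then 0 else lo + hi + δ) ≤ ((M.eRk ((gr M \ I : Finset α) : Set α)).toNat + 4) + ((M.eRk (I : Set α)).toNat + 2) then ((M.eRk ((gr M \ I : Finset α) : Set α)).toNat + 4).choose δ else 0) + 1 * (if lo ≤ (M.eRk (I : Set α)).toNat + 4 ∧ (M.eRk (I : Set α)).toNat + 4 ≤ hi ∧ (if lo = 0 then 0 else lo + hi + δ) ≤ ((M.eRk ((gr M \ I : Finset α) : Set α)).toNat + 2) + ((M.eRk (I : Set α)).toNat + 4) then ((M.eRk ((gr M \ I : Finset α) : Set α)).toNat + 2).choose δ else 0) + 4 * (if lo ≤ (M.eRk (I : Set α)).toNat + 3 ∧ (M.eRk (I : Set α)).toNat + 3 ≤ hi ∧ (if lo = 0 then 0 else lo + hi + δ) ≤ ((M.eRk ((gr M \ I : Finset α) : Set α)).toNat + 4) + ((M.eRk (I : Set α)).toNat + 3) then ((M.eRk ((gr M \ I : Finset α) : Set α)).toNat + 4).choose δ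 else 0) + 4 * (if lo ≤ (M.eRk (I : Set α)).toNat + 4 ∧ (M.eRk (I : Set α)).toNat + 4 ≤ hi ∧ (if lo = 0 then 0 else lo + hi + δ) ≤ ((M.eRk ((gr M \ I : Finset α) : Set α)).toNat + 3) + ((M.eRk (I : Set α)).toNat + 4) then ((M.eRk ((gr M \ I : Finset α) : Set α)).toNat + 3).choose δ else 0)) ≤
      ∑ I ∈ (gr M).powerset, (1 * (if lo + δ ≤ (M.eRk ((gr M \ I : Finset α) : Set α)).toNat + 4 ∧ (M.eRk ((gr M \ I : Finset α) : Set α)).toNat + 4 ≤ hi + δ then ((M.eRk ((gr M \ I : Finset α) : Set α)).toNat + 4).choose δ else 0) + 1 * (if lo + δ ≤ (M.eRk ((gr M \ I : Finset α) : Set α)).toNat + 2 ∧ (M.eRk ((gr M \ I : Finset α) : Set α)).toNat + 2 ≤ hi + δ then ((M.eRk ((gr M \ I : Finset α) : Set α)).toNat + 2).choose δ else 0) + 4 * (if lo + δ ≤ (M.eRk ((gr M \ I : Finset α) : Set α)).toNat + 4 ∧ (M.eRk ((gr M \ I : Finset α) : Set α)).toNat + 4 ≤ hi + δ then ((M.eRk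 ((gr M \ I : Finset α) : Set α)).toNat + 4).choose δ else 0) + 4 * (if lo + δ ≤ (M.eRk ((gr M \ I : Finset α) : Set α)).toNat + 3 ∧ (M.eRk ((gr M \ I : Finset α) : Set α)).toNat + 3 ≤ hi + δ then ((M.eRk ((gr M \ I : Finset α) : Set α)).toNat + 3).choose δ else 0)) := by
  have hr' : M.eRank ≤ ((9 : ℕ) : ℕ∞) := by exact_mod_cast hr
  rcases Nat.lt_or_ge δ 1 with hδ0 | hδ0
  · obtain ⟨hDpos, hadm, hcert⟩ := q4n4_table_9_part0 _ rfl lo (mem_range.2 (by omega)) hi (mem_range.2 (by omega))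
      δ (mem_range.2 (by omega)) hlh
    have key := PLDCert.sum_le_of_cert M hPLD 9 hr' _ hadm _ _ hcert
    rw [← Finset.mul_sum, ← Finset.mul_sum] at key
    exact Nat.le_of_mul_le_mul_left key hDpos
  rcases Nat.lt_or_ge δ 2 with hδ1 | hδ1
  · obtain ⟨hDpos, hadm, hcert⟩ := q4n4_table_9_part1 _ rfl lo (mem_range.2 (by omega)) hi (mem_range.2 (by omega))
      δ (mem_Ico.2 ⟨by omega, by omega⟩) hlh
    have key := PLDCert.sum_le_of_cert M hPLD 9 hr' _ hadm _ _ hcert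
    rw [← Finset.mul_sum, ← Finset.mul_sum] at key
    exact Nat.le_of_mul_le_mul_left key hDpos
  rcases Nat.lt_or_ge δ 3 with hδ2 | hδ2
  · obtain ⟨hDpos, hadm, hcert⟩ := q4n4_table_9_part2 _ rfl lo (mem_range.2 (by omega)) hi (mem_range.2 (by omega))
      δ (mem_Ico.2 ⟨by omega, by omega⟩) hlh
    have key := PLDCert.sum_le_of_cert M hPLD 9 hr' _ hadm _ _ hcert
    rw [← Finset.mul_sum, ← Finset.mul_sum] at key
    exact Nat.le_of_mul_le_mul_left key hDpos
  rcases Nat.lt_or_ge δ 4 with hδ3 | hδ3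
  · obtain ⟨hDpos, hadm, hcert⟩ := q4n4_table_9_part3 _ rfl lo (mem_range.2 (by omega)) hi (mem_range.2 (by omega))
      δ (mem_Ico.2 ⟨by omega, by omega⟩) hlh
    have key := PLDCert.sum_le_of_cert M hPLD 9 hr' _ hadm _ _ hcert
    rw [← Finset.mul_sum, ← Finset.mul_sum] at key
    exact Nat.le_of_mul_le_mul_left key hDpos
  rcases Nat.lt_or_ge δ 4 with hδ4 | hδ4
  · obtain ⟨hDpos, hadm, hcert⟩ := q4n4_table_9_part4 _ rfl lo (mem_range.2 (by omega)) hi (mem_range.2 (by omega))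
      δ (mem_Ico.2 ⟨by omega, by omega⟩) hlh
    have key := PLDCert.sum_le_of_cert M hPLD 9 hr' _ hadm _ _ hcert
    rw [← Finset.mul_sum, ← Finset.mul_sum] at key
    exact Nat.le_of_mul_le_mul_left key hDpos
  rcases Nat.lt_or_ge δ 5 with hδ5 | hδ5
  · obtain ⟨hDpos, hadm, hcert⟩ := q4n4_table_9_part5 _ rfl lo (mem_range.2 (by omega)) hi (mem_range.2 (by omega))
      δ (mem_Ico.2 ⟨by omega, by omega⟩) hlh
    have key := PLDCert.sum_le_of_cert M hPLD 9 hr' _ hadm _ _ hcert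
    rw [← Finset.mul_sum, ← Finset.mul_sum] at key
    exact Nat.le_of_mul_le_mul_left key hDpos
  rcases Nat.lt_or_ge δ 6 with hδ6 | hδ6
  · obtain ⟨hDpos, hadm, hcert⟩ := q4n4_table_9_part6 _ rfl lo (mem_range.2 (by omega)) hi (mem_range.2 (by omega))
      δ (mem_Ico.2 ⟨by omega, by omega⟩) hlh
    have key := PLDCert.sum_le_of_cert M hPLD 9 hr' _ hadm _ _ hcert
    rw [← Finset.mul_sum, ← Finset.mul_sum] at key
    exact Nat.le_of_mul_le_mul_left key hDpos
  rcases Nat.lt_or_ge δ 7 with hδ7 | hδ7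
  · obtain ⟨hDpos, hadm, hcert⟩ := q4n4_table_9_part7 _ rfl lo (mem_range.2 (by omega)) hi (mem_range.2 (by omega))
      δ (mem_Ico.2 ⟨by omega, by omega⟩) hlh
    have key := PLDCert.sum_le_of_cert M hPLD 9 hr' _ hadm _ _ hcert
    rw [← Finset.mul_sum, ← Finset.mul_sum] at key
    exact Nat.le_of_mul_le_mul_left key hDpos
  rcases Nat.lt_or_ge δ 8 with hδ8 | hδ8
  · obtain ⟨hDpos, hadm, hcert⟩ := q4n4_table_9_part8 _ rfl lo (mem_range.2 (by omega)) hi (mem_range.2 (by omega))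
      δ (mem_Ico.2 ⟨by omega, by omega⟩) hlh
    have key := PLDCert.sum_le_of_cert M hPLD 9 hr' _ hadm _ _ hcert
    rw [← Finset.mul_sum, ← Finset.mul_sum] at key
    exact Nat.le_of_mul_le_mul_left key hDpos
  rcases Nat.lt_or_ge δ 9 with hδ9 | hδ9
  · obtain ⟨hDpos, hadm, hcert⟩ := q4n4_table_9_part9 _ rfl lo (mem_range.2 (by omega)) hi (mem_range.2 (by omega))
      δ (mem_Ico.2 ⟨by omega, by omega⟩) hlh
    have key := PLDCert.sum_le_of_cert M hPLD 9 hr' _ hadm _ _ hcert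
    rw [← Finset.mul_sum, ← Finset.mul_sum] at key
    exact Nat.le_of_mul_le_mul_left key hDpos
  rcases Nat.lt_or_ge δ 10 with hδ10 | hδ10
  · obtain ⟨hDpos, hadm, hcert⟩ := q4n4_table_9_part10 _ rfl lo (mem_range.2 (by omega)) hi (mem_range.2 (by omega))
      δ (mem_Ico.2 ⟨by omega, by omega⟩) hlh
    have key := PLDCert.sum_le_of_cert M hPLD 9 hr' _ hadm _ _ hcert
    rw [← Finset.mul_sum, ← Finset.mul_sum] at key
    exact Nat.le_of_mul_le_mul_left key hDpos
  rcases Nat.lt_or_ge δ 10 with hδ11 | hδ11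
  · obtain ⟨hDpos, hadm, hcert⟩ := q4n4_table_9_part11 _ rfl lo (mem_range.2 (by omega)) hi (mem_range.2 (by omega))
      δ (mem_Ico.2 ⟨by omega, by omega⟩) hlh
    have key := PLDCert.sum_le_of_cert M hPLD 9 hr' _ hadm _ _ hcert
    rw [← Finset.mul_sum, ← Finset.mul_sum] at key
    exact Nat.le_of_mul_le_mul_left key hDpos
  rcases Nat.lt_or_ge δ 11 with hδ12 | hδ12
  · obtain ⟨hDpos, hadm, hcert⟩ := q4n4_table_9_part12 _ rfl lo (mem_range.2 (by omega)) hi (mem_range.2 (by omega))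
      δ (mem_Ico.2 ⟨by omega, by omega⟩) hlh
    have key := PLDCert.sum_le_of_cert M hPLD 9 hr' _ hadm _ _ hcert
    rw [← Finset.mul_sum, ← Finset.mul_sum] at key
    exact Nat.le_of_mul_le_mul_left key hDpos
  rcases Nat.lt_or_ge δ 12 with hδ13 | hδ13
  · obtain ⟨hDpos, hadm, hcert⟩ := q4n4_table_9_part13 _ rfl lo (mem_range.2 (by omega)) hi (mem_range.2 (by omega))
      δ (mem_Ico.2 ⟨by omega, by omega⟩) hlh
    have key := PLDCert.sum_le_of_cert M hPLD 9 hr' _ hadm _ _ hcert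
    rw [← Finset.mul_sum, ← Finset.mul_sum] at key
    exact Nat.le_of_mul_le_mul_left key hDpos
  rcases Nat.lt_or_ge δ 13 with hδ14 | hδ14
  · obtain ⟨hDpos, hadm, hcert⟩ := q4n4_table_9_part14 _ rfl lo (mem_range.2 (by omega)) hi (mem_range.2 (by omega))
      δ (mem_Ico.2 ⟨by omega, by omega⟩) hlh
    have key := PLDCert.sum_le_of_cert M hPLD 9 hr' _ hadm _ _ hcert
    rw [← Finset.mul_sum, ← Finset.mul_sum] at key
    exact Nat.le_of_mul_le_mul_left key hDpos
  obtain ⟨hDpos, hadm, hcert⟩ := q4n4_table_9_part15 _ rfl lo (mem_range.2 (by omega)) hi (mem_range.2 (by omega))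
    δ (mem_Ico.2 ⟨by omega, by omega⟩) hlh
  have key := PLDCert.sum_le_of_cert M hPLD 9 hr' _ hadm _ _ hcert
  rw [← Finset.mul_sum, ← Finset.mul_sum] at key
  exact Nat.le_of_mul_le_mul_left key hDpos

end PLDPlaneTable

end PercRepro
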